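import Literature.AlgebraicGeometry.Resolution.RoofInField
import Literature.AlgebraicGeometry.Resolution.SmoothUniformization
import Mathlib.RingTheory.ZariskisMainTheorem
import HarnessLib

/-!
# The cut of the disc from Zariski's Main Theorem

Topic: `Literature/AlgebraicGeometry/Resolution` (valued function fields). M. Temkin, *Inseparable
local uniformization*, J. Algebra 373 (2013), proof of Thm. 3.3.1, Step 3: Temkin cuts the fibre
of the `K₁`-model down to the disc by semistable reduction. The chart datum of the tree
(`RelCurveChart`, field `hx'int`) needs the cut in the form "`x′ rⁿ` is integral over the ring of
the cut for a `V`-unit `r`", and this is exactly what the ALGEBRAIC Zariski Main Theorem of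
Mathlib (`Algebra.ZariskisMainProperty.of_finiteType`, after Stacks 00Q9) produces from a
quasi-finiteness statement. This file packages that deduction, inside one ambient field `Ω` with
a valuation ring `V`:

* `exists_unit_forall_isIntegral_of_fibre` — for a normal subring `R₁ ⊆ O_V` of `Ω` and a finitely
  generated extension `S = R₁[s₁, …, s_k] ⊆ O_V`, if the fibre of `Spec S → Spec R₁` through the
  centre `𝔮` of `V` is finite and has no point strictly below `𝔮`, then there is `r ∈ S` with
  `|r| = 1` such that every element of `S` times a power of `r` is integral over `R₁` — PROVED;
* `exists_unit_locAway_of_fibre` — if moreover `S` is birational over `R₁` (fraction forms), then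
  `r ∈ R₁` and `S ⊆ R₁[1/r]` — PROVED.

All statements are [folklore] consequences of [Stacks, Tag 00Q9] (Mathlib); no definitions, no
named facts. The quasi-finiteness input (the finiteness of the fibre) is where the geometry of
Thm. 3.3.1 enters; it is supplied by the E-chart in the files using this one.

## Sources

* The Stacks Project, Tag 00Q9 (Zariski's Main Theorem, algebraic form) — Mathlib
  `Mathlib/RingTheory/ZariskisMainTheorem.lean`.
* M. Temkin, arXiv:0804.1554v3, proof of Thm. 3.3.1, Step 3. [Temkin2013]
-/

noncomputable section

open IsLocalRing

namespace Literature.AlgebraicGeometry.Resolution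

universe u

variable {Ω : Type u} [Field Ω] (V : ValuationSubring Ω)
variable {A : Type u} [CommRing A] [Algebra A Ω]

/-- **Zariski's Main Theorem, applied.** Let `R₁ ⊆ Ω` be a subalgebra, `S = R₁[gens] ⊆ O_V` a
finitely generated `R₁`-subalgebra of `Ω`, `𝔮` the centre of `V` on `S` and `𝔭₁ = 𝔮 ∩ R₁`. If the
set of primes of `S` over `𝔭₁` is finite and none of them lies strictly below `𝔮`, then there is
`r ∈ S` with `|r| = 1` such that for every `x ∈ S` some `rᵐ x` is integral over `R₁`.
[cite: StacksProject, Tag 00Q9] (Mathlib `Algebra.ZariskisMainProperty.of_finiteType`) -/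
theorem exists_unit_forall_isIntegral_of_fibre (R₁ : Subalgebra A Ω) (gens : Finset Ω)
    (hSV : (Algebra.adjoin R₁ (↑gens : Set Ω)).toSubring ≤ V.toSubring)
    (hfin : {P : PrimeSpectrum (Algebra.adjoin R₁ (↑gens : Set Ω)) |
      P.asIdeal.comap (algebraMap R₁ (Algebra.adjoin R₁ (↑gens : Set Ω))) =
        (centre _ V hSV).comap (algebraMap R₁ (Algebra.adjoin R₁ (↑gens : Set Ω)))}.Finite)
    (hmin : ∀ P : Ideal (Algebra.adjoin R₁ (↑gens : Set Ω)), P.IsPrime →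
      P.comap (algebraMap R₁ _) = (centre _ V hSV).comap (algebraMap R₁ _) →
      P ≤ centre _ V hSV → P = centre _ V hSV) :
    ∃ r : Algebra.adjoin R₁ (↑gens : Set Ω), V.valuation (r : Ω) = 1 ∧
      ∀ x : Algebra.adjoin R₁ (↑gens : Set Ω), ∃ m : ℕ, IsIntegral R₁ (r ^ m * x) := by
  classical
  set S := Algebra.adjoin R₁ (↑gens : Set Ω) with hS
  haveI : Algebra.FiniteType R₁ S :=
    (Subalgebra.fg_iff_finiteType _).mp ⟨gens, rfl⟩
  set 𝔮 : Ideal S := centre S V hSV with h𝔮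
  haveI h𝔮p : 𝔮.IsPrime := centre.isPrime S V hSV
  let q : PrimeSpectrum S := ⟨𝔮, h𝔮p⟩
  -- `{q}` is open in its fibre
  have hopen : IsOpen (X := (PrimeSpectrum.comap (algebraMap R₁ S)) ⁻¹' {q.comap (algebraMap R₁ S)})
      {⟨q, rfl⟩} := by
    rw [isOpen_induced_iff]
    -- for each fibre point `P ≠ q` pick `s_P ∈ P \ 𝔮`
    have hsep : ∀ P : PrimeSpectrum S, P.asIdeal.comap (algebraMap R₁ S) = 𝔮.comap (algebraMap R₁ S) →
        P ≠ q → ∃ s : S, s ∈ P.asIdeal ∧ s ∉ 𝔮 := by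
      intro P hP hne
      by_contra hcon
      have hle : P.asIdeal ≤ 𝔮 := fun s hs => by
        by_contra hs'
        exact hcon ⟨s, hs, hs'⟩
      exact hne (PrimeSpectrum.ext (hmin P.asIdeal P.2 hP hle))
    let F : Set (PrimeSpectrum S) := {P | P.asIdeal.comap (algebraMap R₁ S) = 𝔮.comap (algebraMap R₁ S)}
    have hF : F.Finite := hfin
    let U : Set (PrimeSpectrum S) :=
      ⋂ P ∈ hF.toFinset.erase q, (PrimeSpectrum.basicOpen
        (if h : P.asIdeal.comap (algebraMap R₁ S) = 𝔮.comap (algebraMap R₁ S) ∧ P ≠ q then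
          (hsep P h.1 h.2).choose else 1) : Set (PrimeSpectrum S))
    refine ⟨U, ?_, ?_⟩
    · refine Set.Finite.isOpen_biInter (Finset.finite_toSet _) fun P _ => ?_
      exact PrimeSpectrum.isOpen_basicOpen
    · ext ⟨P, hP⟩
      simp only [Set.mem_preimage, Set.mem_singleton_iff, Subtype.mk.injEq]
      have hPF : P.asIdeal.comap (algebraMap R₁ S) = 𝔮.comap (algebraMap R₁ S) := by
        have := hP
        simp only [Set.mem_preimage, Set.mem_singleton_iff] at this
        exact congrArg PrimeSpectrum.asIdeal this
      constructor
      · intro hU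
        by_contra hne
        have hmem : P ∈ hF.toFinset.erase q := by
          rw [Finset.mem_erase]; exact ⟨hne, hF.mem_toFinset.mpr hPF⟩
        have := Set.mem_iInter₂.mp hU P hmem
        rw [dif_pos ⟨hPF, hne⟩] at this
        exact (PrimeSpectrum.mem_basicOpen _ _).mp this (hsep P hPF hne).choose_spec.1
      · rintro rfl
        refine Set.mem_iInter₂.mpr fun P hPm => ?_
        have hP' := Finset.mem_erase.mp hPm
        have hPF' : P.asIdeal.comap (algebraMap R₁ S) = 𝔮.comap (algebraMap R₁ S) := hF.mem_toFinset.mp hP'.2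
        rw [dif_pos ⟨hPF', hP'.1⟩]
        exact (PrimeSpectrum.mem_basicOpen _ _).mpr (hsep P hPF' hP'.1).choose_spec.2
  haveI : Algebra.QuasiFiniteAt R₁ q.asIdeal := Algebra.QuasiFiniteAt.of_isOpen_singleton_fiber q hopen
  have hZ : Algebra.ZariskisMainProperty R₁ q.asIdeal := Algebra.ZariskisMainProperty.of_finiteType _
  obtain ⟨r, hr𝔮, H⟩ := Algebra.zariskisMainProperty_iff'.mp hZ
  have hr1 : V.valuation (r : Ω) = 1 := by
    have hle : V.valuation (r : Ω) ≤ 1 := (V.valuation_le_one_iff _).mpr (hSV r.2)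
    have hnlt : ¬ V.valuation (r : Ω) < 1 := fun hlt => hr𝔮 ((mem_centre_iff S V hSV r).mpr hlt)
    exact le_antisymm hle (not_lt.mp hnlt)
  exact ⟨r, hr1, H⟩

/-- Membership from integrality and a fraction form, for a normal subalgebra realized in `Ω`
(a copy of the bookkeeping lemma of `DChartRoof.lean`, kept private to keep imports light).
[folklore] -/
private theorem mem_of_isIntegral_of_mul_mem' (T : Subalgebra A Ω) [IsIntegrallyClosed T] {z : Ω}
    (hz : IsIntegral T z) {u : Ω} (huT : u ∈ T) (hu0 : u ≠ 0) (huz : u * z ∈ T) : z ∈ T := by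
  haveI : IsDomain T := Function.Injective.isDomain (algebraMap T Ω) Subtype.val_injective
  let Kf := FractionRing T
  have hinj : Function.Injective (algebraMap T Ω) := Subtype.val_injective
  let φ : Kf →+* Ω := IsFractionRing.lift hinj
  have hφalg : ∀ t : T, φ (algebraMap T Kf t) = (t : Ω) := fun t => IsFractionRing.lift_algebraMap hinj t
  have hu' : (⟨u, huT⟩ : T) ∈ nonZeroDivisors T :=
    mem_nonZeroDivisors_of_ne_zero fun h0 => hu0 (congrArg Subtype.val h0)
  set xK : Kf := IsLocalization.mk' Kf (⟨u * z, huz⟩ : T) ⟨⟨u, huT⟩, hu'⟩ with hxK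
  have hφx : φ xK = z := by
    have h1 : xK * algebraMap T Kf ⟨u, huT⟩ = algebraMap T Kf ⟨u * z, huz⟩ := IsLocalization.mk'_spec Kf _ _
    have h2 := congrArg φ h1
    rw [map_mul, hφalg, hφalg] at h2
    have h3 : φ xK * u = z * u := by rw [h2]; exact mul_comm u z
    exact mul_right_cancel₀ hu0 h3
  have hxint : IsIntegral T xK := by
    obtain ⟨p, hpm, hpz⟩ := hz
    refine ⟨p, hpm, ?_⟩
    apply φ.injective
    rw [Polynomial.hom_eval₂, map_zero]
    have hcomp : φ.comp (algebraMap T Kf) = algebraMap T Ω := RingHom.ext fun t => hφalg t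
    rw [hcomp, hφx]
    exact hpz
  obtain ⟨y, hy⟩ := (IsIntegrallyClosed.isIntegral_iff (R := T) (K := Kf)).mp hxint
  have : (y : Ω) = z := by rw [← hφalg, hy, hφx]
  rw [← this]
  exact y.2

/-- Fraction forms pass from generators to the generated algebra (inside a field). [folklore] -/
theorem exists_frac_of_mem_adjoin (R₁ : Subalgebra A Ω) (gens : Set Ω)
    (hfrac : ∀ s ∈ gens, ∃ u ∈ R₁, u ≠ 0 ∧ u * s ∈ R₁) {z : Ω}
    (hz : z ∈ Algebra.adjoin R₁ gens) : ∃ u ∈ R₁, u ≠ 0 ∧ u * z ∈ R₁ := by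
  induction hz using Algebra.adjoin_induction with
  | mem x hx => exact hfrac x hx
  | algebraMap r => exact ⟨1, R₁.one_mem, one_ne_zero, by rw [one_mul]; exact r.2⟩
  | add x y _ _ hx hy =>
    obtain ⟨u, huR, hu0, hux⟩ := hx
    obtain ⟨w, hwR, hw0, hwy⟩ := hy
    refine ⟨u * w, R₁.mul_mem huR hwR, mul_ne_zero hu0 hw0, ?_⟩
    have : u * w * (x + y) = w * (u * x) + u * (w * y) := by ring
    rw [this]
    exact R₁.add_mem (R₁.mul_mem hwR hux) (R₁.mul_mem huR hwy)
  | mul x y _ _ hx hy =>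
    obtain ⟨u, huR, hu0, hux⟩ := hx
    obtain ⟨w, hwR, hw0, hwy⟩ := hy
    refine ⟨u * w, R₁.mul_mem huR hwR, mul_ne_zero hu0 hw0, ?_⟩
    have : u * w * (x * y) = (u * x) * (w * y) := by ring
    rw [this]
    exact R₁.mul_mem hux hwy

/-- **Zariski's Main Theorem, applied (birational form).** In the situation of
`exists_unit_forall_isIntegral_of_fibre`, if `R₁` is normal and the generators have fraction
forms over `R₁` (`S` is birational over `R₁`), then the unit `r` lies in `R₁` and
`gens ⊆ R₁[1/r]`. [cite: StacksProject, Tag 00Q9] -/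
theorem exists_unit_locAway_of_fibre (R₁ : Subalgebra A Ω) [IsIntegrallyClosed R₁] (gens : Finset Ω)
    (hSV : (Algebra.adjoin R₁ (↑gens : Set Ω)).toSubring ≤ V.toSubring)
    (hfin : {P : PrimeSpectrum (Algebra.adjoin R₁ (↑gens : Set Ω)) |
      P.asIdeal.comap (algebraMap R₁ (Algebra.adjoin R₁ (↑gens : Set Ω))) =
        (centre _ V hSV).comap (algebraMap R₁ (Algebra.adjoin R₁ (↑gens : Set Ω)))}.Finite)
    (hmin : ∀ P : Ideal (Algebra.adjoin R₁ (↑gens : Set Ω)), P.IsPrime →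
      P.comap (algebraMap R₁ _) = (centre _ V hSV).comap (algebraMap R₁ _) →
      P ≤ centre _ V hSV → P = centre _ V hSV)
    (hfrac : ∀ s ∈ (↑gens : Set Ω), ∃ u ∈ R₁, u ≠ 0 ∧ u * s ∈ R₁) :
    ∃ r : Ω, ∃ hr : r ∈ R₁, V.valuation r = 1 ∧ ∀ s ∈ (↑gens : Set Ω), s ∈ locAway R₁ r hr := by
  set S := Algebra.adjoin R₁ (↑gens : Set Ω) with hS
  obtain ⟨r, hr1, H⟩ := exists_unit_forall_isIntegral_of_fibre V R₁ gens hSV hfin hmin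
  -- integrality in `S` gives integrality in `Ω`
  have hmapint : ∀ z : S, IsIntegral R₁ z → IsIntegral R₁ (z : Ω) := fun z hz =>
    hz.map (IsScalarTower.toAlgHom R₁ S Ω)
  -- `r ∈ R₁`
  have hrR : (r : Ω) ∈ R₁ := by
    obtain ⟨m, hm⟩ := H r
    rw [← pow_succ] at hm
    have hri : IsIntegral R₁ r := (IsIntegral.pow_iff (Nat.succ_pos m)).mp hm
    obtain ⟨u, huR, hu0, hur⟩ := exists_frac_of_mem_adjoin R₁ (↑gens : Set Ω) hfrac r.2
    exact mem_of_isIntegral_of_mul_mem' R₁ (hmapint r hri) huR hu0 hur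
  refine ⟨r, hrR, hr1, fun s hs => ?_⟩
  obtain ⟨m, hm⟩ := H ⟨s, Algebra.subset_adjoin hs⟩
  have hint : IsIntegral R₁ ((r : Ω) ^ m * s) := by
    have := hmapint _ hm
    simpa using this
  obtain ⟨u, huR, hu0, hu⟩ := exists_frac_of_mem_adjoin R₁ (↑gens : Set Ω) hfrac
    (S.mul_mem (S.pow_mem r.2 m) (Algebra.subset_adjoin hs) : (r : Ω) ^ m * s ∈ S)
  have hmem : (r : Ω) ^ m * s ∈ R₁ := mem_of_isIntegral_of_mul_mem' R₁ hint huR hu0 hu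
  refine (mem_locAway_iff (hf := hrR)).mpr ⟨m, ?_⟩
  rw [mul_comm]
  exact hmem

end Literature.AlgebraicGeometry.Resolution

end
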